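import Mathlib
import Summits.Ventures.HodgeRepro.Tier4.Common.LocalTorusCompact
import Summits.Ventures.HodgeRepro.Tier4.Line1.TotallyDefiniteCompact

/-!
# Tier4/Line4/DefiniteCompact — C-L4-DEF-COMPACT (A): a definite real place gives a compact slice `U(W)(k_w)`

Blind re-derivation cell `pub-hodge-repro`, Tier 4 «prove the step» (README §9–§10), seat t4-L1-p1 (prover, LINE L1,
gen 4; lead g387's cut S15587 on the empty L4 chair, statement S15619, part (A)).  Tree path
`lean/Summits/Ventures/HodgeRepro/Tier4/Line4/DefiniteCompact.lean`.  Mathlib-level; no literature.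

WHAT IS PROVED (every declaration sorry-free, axioms `[propext, Classical.choice, Quot.sound]`).
* **`isCompact_atPlace_of_definite (W) {w} (hw : w.IsReal) (hdef : (W.B.map (embedding_of_isReal hw)).PosDef ∨
  (-(W.B.map (embedding_of_isReal hw))).PosDef) : IsCompact (atPlace W w : Set (GA W))`** — the bridge «definite ⇒
  compact slice» (`hcpt ⇐ hdef`, crit-1 S15584): the slice `G_w = U(W)(k_w)` is closed in `G(𝔸_k)` and lies in the
  preimage, under the closed embedding `g ↦ (g, g⁻¹)`, of the compact `torusBox ×ˢ op '' torusBox` — the `w`-entries of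
  every unitary element are bounded by L1-p2's definite bound (`exists_realMat_entry_bound`), the other components are
  those of the identity (`infPart_entry_of_isAtPlace`, `finPart_entry_of_isAtPlace`).  The proof is typer-2's
  `isCompact_localTorusAt_ofLinesRow` with the definite bound in place of the norm-one ellipse.
* `compactSpace_atPlace_of_definite` — the typeclass form.

Part (B) of S15619 (the line's shape: `isCompact_atPlace_ofLinesRow_of_signs`, `hcpt_mixedRow_of_hdef` from `IsCMAt`
and the sign clause at general trace `t`) is NOT here — see the seat's HANDOFF.

Nothing here says anything about the status of the Hodge conjecture for CM abelian varieties, which is NOT proved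
(HC_CM is NOT proved by anyone in this repository).
-/

set_option autoImplicit false
noncomputable section
namespace Summit.Ventures.HodgeRepro.Tier4.Line4
open Summit.Ventures.HodgeRepro.Tier4 Summit.Ventures.HodgeRepro.Tier4.Common Summit.Ventures.HodgeRepro.Tier4.Line1
  NumberField Matrix

section DefiniteCompact

variable {k : Type} [Field k] [NumberField k] (W : PlaneData k)

/-- **the matrix of an element supported at a definite real place lies in the box** `torusBox hw C`, `C` the definite
bound of L1-p2's `exists_realMat_entry_bound`. -/
theorem mem_torusBox_of_isAtPlace {w : InfinitePlace k} (hw : w.IsReal) {C : ℝ}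
    (hC : ∀ g : GA W, ∀ i j, |realMat W hw g i j| ≤ C) {g : GA W} (hg : IsAtPlace W w g) :
    GA.mat W g ∈ torusBox hw C := by
  refine Set.mem_univ_pi.2 fun i => Set.mem_univ_pi.2 fun j => mem_entryBoxAt hw _ _ _ (hC g i j) ?_ ?_
  · exact fun w' hw' => infPart_entry_of_isAtPlace hg i j w' hw'
  · exact finPart_entry_of_isAtPlace hg i j

/-- **C-L4-DEF-COMPACT (A) — a definite real place gives a compact slice**: if the real Gram matrix `B.map σ_w` at the
real place `w` is positive or negative definite, the slice `G_w = U(W)(k_w)` (the elements of `G(𝔸_k)` supported at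
`w`) is compact: closed, and inside the preimage of the compact `torusBox ×ˢ op '' torusBox` under the closed embedding
`g ↦ (g, g⁻¹)` (both `g` and `g⁻¹` are supported at `w` with `w`-entries bounded by the definite bound). -/
theorem isCompact_atPlace_of_definite {w : InfinitePlace k} (hw : w.IsReal)
    (hdef : (W.B.map (InfinitePlace.embedding_of_isReal hw)).PosDef ∨
      (-(W.B.map (InfinitePlace.embedding_of_isReal hw))).PosDef) :
    IsCompact (atPlace W w : Set (GA W)) := by
  obtain ⟨C, hC⟩ := exists_realMat_entry_bound W hw hdef
  have hP : IsCompact ((torusBox hw C) ×ˢ (MulOpposite.op '' torusBox hw C)) :=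
    (isCompact_torusBox hw C).prod ((isCompact_torusBox hw C).image MulOpposite.continuous_op)
  have hpre : IsCompact ((fun g : GA W => Units.embedProduct (M4 k) (g : GL4 k)) ⁻¹'
      ((torusBox hw C) ×ˢ (MulOpposite.op '' torusBox hw C))) :=
    (isClosedEmbedding_embed W).isCompact_preimage hP
  refine hpre.of_isClosed_subset (isClosed_atPlace W w) ?_
  intro g hg
  show Units.embedProduct (M4 k) (g : GL4 k) ∈ (torusBox hw C) ×ˢ (MulOpposite.op '' torusBox hw C)
  rw [Units.embedProduct_apply]
  refine ⟨mem_torusBox_of_isAtPlace W hw hC hg, ?_⟩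
  refine ⟨GA.mat W g⁻¹, mem_torusBox_of_isAtPlace W hw hC ((atPlace W w).inv_mem hg), ?_⟩
  rfl

/-- The typeclass form: `atPlace W w` is a compact space at a definite real place. -/
theorem compactSpace_atPlace_of_definite {w : InfinitePlace k} (hw : w.IsReal)
    (hdef : (W.B.map (InfinitePlace.embedding_of_isReal hw)).PosDef ∨
      (-(W.B.map (InfinitePlace.embedding_of_isReal hw))).PosDef) :
    CompactSpace (atPlace W w) :=
  isCompact_iff_compactSpace.1 (isCompact_atPlace_of_definite W hw hdef)

end DefiniteCompact

end Summit.Ventures.HodgeRepro.Tier4.Line4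

end
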